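import Mathlib
import Literature.AlgebraicGeometry.Resolution.CobordantGame
import Literature.AlgebraicGeometry.Resolution.CobordantChartCoefficients

/-!
# `LocalWeightedDrop`: singular successors of the point blow-up lie on the tangent cone

Route `ResolutionOfSingularities/WeightedInvariant`, crux `LocalWeightedDrop` (stmt-ResolutionOfSingularities-8899), line
`hasse-ridge-face-selection` (chain w43, [OURS · L1 W4.3]); first positional fact for the surface pieces S2/S3.  Under the
point blow-up (all weights `1`) of a germ `f` of order `d`, the `s`-saturated transform at the exceptional point `c` is
`s^d · G` and `G(0) = in_d f (c)` (`CobordantChart.successor_singular_iff`); so a SINGULAR successor can only sit at a point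
of the projectivised tangent cone: `in_d f (c) = 0` (`initEval_eq_zero_of_isSuccessor`).  For a unary cone `in_d f = λ · ℓ^d`
(the wild pieces S2/S3) every near point therefore lies on the line `ℓ(c) = 0` of the exceptional plane
(`linearForm_eq_zero_of_isSuccessor`) — CJS's "near points lie over the directrix", first instance.
-/

set_option linter.dupNamespace false -- mandated namespace of this single-conjunct summit

namespace Summit.ResolutionOfSingularities.ResolutionOfSingularities.Theorems

open Literature.AlgebraicGeometry.Resolution

namespace NearPointsOnCone

variable {k : Type} [Field k] {n : ℕ}

/-- SINGULAR SUCCESSORS OF THE POINT BLOW-UP LIE ON THE TANGENT CONE: if `f ≠ 0` has order `d` and `G` is a singular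
successor of `f` under the move `(X, (1, …, 1))` at the exceptional point `c`, then `in_d f (c) = 0`. -/
theorem initEval_eq_zero_of_isSuccessor {f : MvPowerSeries (Fin n) k} {d : ℕ} (hfd : f.order = d)
    {G : MvPowerSeries (Fin (n + 1)) k}
    (hG : CobordantGame.IsSuccessor k f (MvPowerSeries.X : Fin n → MvPowerSeries (Fin n) k) (fun _ => 1) G) :
    ∃ c : Fin n → k, c ≠ 0 ∧ (∃ a : ℕ, MvPowerSeries.subst (CobordantChart.chart (fun _ : Fin n => 1) c) f =
        MvPowerSeries.X 0 ^ a * G ∧ ¬ (MvPowerSeries.X (0 : Fin (n + 1)) ∣ G)) ∧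
      CobordantChart.initEval (fun _ : Fin n => 1) c d f = 0 := by
  obtain ⟨c, a, ⟨i, -, hci⟩, hfac, hndvd, hsing⟩ := hG
  have hf : f ≠ 0 := by
    rintro rfl
    rw [MvPowerSeries.order_zero] at hfd
    exact ENat.top_ne_coe d hfd
  have hconv : ∀ i, (fun _ : Fin n => 1) i = 0 → c i = 0 := fun i hi => absurd hi one_ne_zero
  have hchart : CobordantGame.cruxChart k (fun _ : Fin n => 1) c = CobordantChart.chart (fun _ : Fin n => 1) c := by
    have h := CobordantChart.cruxChart_eq_chart (k := k) (fun _ : Fin n => 1) c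
    simp only [Nat.one_pos, if_true] at h
    exact h
  have hself : MvPowerSeries.subst (MvPowerSeries.X : Fin n → MvPowerSeries (Fin n) k) f = f := by
    rw [MvPowerSeries.subst_self]; rfl
  rw [hchart, hself] at hfac
  have had : a = d := by
    have h : (a : ℕ∞) = f.weightedOrder (fun _ : Fin n => 1) :=
      CobordantChart.eq_weightedOrder_of_factor _ c hconv hf hfac hndvd
    change (a : ℕ∞) = f.order at h
    rw [hfd] at h
    exact_mod_cast h
  refine ⟨c, fun h0 => hci (by rw [h0]; rfl), ⟨a, hfac, hndvd⟩, ?_⟩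
  have h := ((CobordantChart.successor_singular_iff (fun _ : Fin n => 1) c hconv f hfac).mp hsing).1
  rwa [had] at h

/-- NEAR POINTS OF A UNARY CONE LIE OVER THE DIRECTRIX: if the degree-`d` form of `f` is `λ · ℓ^d` as a function
(`λ ≠ 0`), every singular successor of the point blow-up sits at a point `c` with `ℓ(c) = 0`. -/
theorem linearForm_eq_zero_of_isSuccessor {f : MvPowerSeries (Fin n) k} {d : ℕ} (hfd : f.order = d)
    {lam : k} (hlam : lam ≠ 0) {ℓ : Fin n → k}
    (hcone : ∀ v : Fin n → k, CobordantChart.initEval (fun _ : Fin n => 1) v d f = lam * (∑ i, ℓ i * v i) ^ d)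
    {G : MvPowerSeries (Fin (n + 1)) k}
    (hG : CobordantGame.IsSuccessor k f (MvPowerSeries.X : Fin n → MvPowerSeries (Fin n) k) (fun _ => 1) G) :
    ∃ c : Fin n → k, c ≠ 0 ∧ (∃ a : ℕ, MvPowerSeries.subst (CobordantChart.chart (fun _ : Fin n => 1) c) f =
        MvPowerSeries.X 0 ^ a * G ∧ ¬ (MvPowerSeries.X (0 : Fin (n + 1)) ∣ G)) ∧ ∑ i, ℓ i * c i = 0 := by
  obtain ⟨c, hc0, hfac, hev⟩ := initEval_eq_zero_of_isSuccessor hfd hG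
  refine ⟨c, hc0, hfac, ?_⟩
  rw [hcone c] at hev
  rcases mul_eq_zero.mp hev with h | h
  · exact absurd h hlam
  · exact pow_eq_zero_iff' |>.mp h |>.1

end NearPointsOnCone

end Summit.ResolutionOfSingularities.ResolutionOfSingularities.Theorems
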